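import Literature.Analysis.DeBrangesSpaces.SonineMellinEntire
import HarnessLib

/-!
# Burnol 2001 (CRAS 333), §1: `𝓕₊(𝟙_{t≥a}(log t)^k t^{w−1}) = (d/dw)^k C_a(·,w)` for `Re w < 0`

Burnol's vectors `X^λ_{w,k} = 𝟙_{t≥λ}(d^k/d^kw)C_λ(t,w)` (`Re w ≤ 1/2`, TeX l.393–396) are, for
`Re w < 0` where everything converges absolutely, the cosine transforms of the `w`-derivatives
`𝟙_{t≥a}(log t)^k t^{w−1}` of `𝟙_{t≥a}t^{w−1}` ("`𝓕₊` of `𝟙_{t≥a}t^{s−1}`", TeX l.326–332; the tree's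
`SonineMellin.fourierIntegral_gw` is the case `k = 0`).  We prove, for `a > 0`, `u ≠ 0`, `Re w < 0`:

  `𝓕(𝟙_{|x|>a}(log|x|)^k|x|^{w−1})(u) = (d/dw)^k C_a(u,w)`   (`fourier_indicator_log_pow_cpow`),

by differentiating the Fourier integral under the integral sign in `w` (majorant
`𝟙_{|x|>a}|log|x||^{k+1}(|x|^{σ₁−1} + |x|^{σ₂−1})`, integrable for `σ₂ < 0`).
Brick 3′ of the proof of Théorème 1.5 (`Burnol2001CRAS_thm1_5C`): it identifies the `Re w < 0`
representers of the compensated pairing with Fourier transforms of explicit `L¹ ∩ L²` functions.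
RH-FREE.

## References
* [Burnol2001CRAS] J.-F. Burnol, C. R. Acad. Sci. Paris 333 (2001) 201–206, §1 (TeX l.326–332,
  393–400).
-/

open MeasureTheory Set Filter Complex Metric
open scoped Real Topology ENNReal FourierTransform

open Literature.Analysis.DeBrangesSpaces.SonineMellin (cosKernel differentiable_cosKernel
  fourierIntegral_gw)

namespace Literature.Analysis.DeBrangesSpaces

namespace Burnol2001

/-! ## A. `𝟙_{|x|>a}|log|x||^m |x|^{σ−1}` is integrable for `σ < 0` -/

/-- `|log t|^n ≤ (2/η)^n (t^{nη} + t^{−nη})` for `t > 0`, `η > 0`. [folklore] -/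
private theorem abs_log_pow_le' {t η : ℝ} (ht : 0 < t) (hη : 0 < η) (n : ℕ) :
    |Real.log t| ^ n ≤ (2 / η) ^ n * (t ^ (n * η) + t ^ (-(n * η))) := by
  have h1 : 0 ≤ t ^ η := Real.rpow_nonneg ht.le _
  have h2 : 0 ≤ t ^ (-η) := Real.rpow_nonneg ht.le _
  have h3 : |Real.log t| ≤ (t ^ η + t ^ (-η)) / η := by
    rcases le_or_gt 1 t with h | h
    · rw [abs_of_nonneg (Real.log_nonneg h)]
      calc Real.log t ≤ t ^ η / η := Real.log_le_rpow_div ht.le hη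
        _ ≤ (t ^ η + t ^ (-η)) / η := by gcongr; linarith
    · rw [abs_of_neg (Real.log_neg ht h), ← Real.log_inv]
      calc Real.log t⁻¹ ≤ t⁻¹ ^ η / η := Real.log_le_rpow_div (inv_nonneg.2 ht.le) hη
        _ = t ^ (-η) / η := by rw [Real.inv_rpow ht.le, Real.rpow_neg ht.le]
        _ ≤ (t ^ η + t ^ (-η)) / η := by gcongr; linarith
  have h4 : |Real.log t| ^ n ≤ ((t ^ η + t ^ (-η)) / η) ^ n :=
    pow_le_pow_left₀ (abs_nonneg _) h3 n
  have h5 : (t ^ η + t ^ (-η)) ^ n ≤ 2 ^ n * ((t ^ η) ^ n + (t ^ (-η)) ^ n) := by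
    calc (t ^ η + t ^ (-η)) ^ n ≤ 2 ^ (n - 1) * ((t ^ η) ^ n + (t ^ (-η)) ^ n) := add_pow_le h1 h2 n
      _ ≤ 2 ^ n * ((t ^ η) ^ n + (t ^ (-η)) ^ n) :=
          mul_le_mul_of_nonneg_right (pow_le_pow_right₀ (by norm_num : (1 : ℝ) ≤ 2) (Nat.sub_le n 1))
            (by positivity)
  rw [← Real.rpow_natCast (t ^ η), ← Real.rpow_natCast (t ^ (-η)), ← Real.rpow_mul ht.le,
    ← Real.rpow_mul ht.le] at h5
  calc |Real.log t| ^ n ≤ ((t ^ η + t ^ (-η)) / η) ^ n := h4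
    _ = (t ^ η + t ^ (-η)) ^ n / η ^ n := by rw [div_pow]
    _ ≤ 2 ^ n * (t ^ (η * n) + t ^ (-η * n)) / η ^ n := by gcongr
    _ = (2 / η) ^ n * (t ^ (n * η) + t ^ (-(n * η))) := by
        rw [div_pow, mul_comm η n, show -η * (n : ℝ) = -(n * η) by ring]; ring

/-- `|log t|^m t^{σ−1}` is integrable on `(a,∞)` for `σ < 0`, `a > 0`. [folklore] -/
private theorem integrableOn_abs_log_pow_mul_rpow {a : ℝ} (ha : 0 < a) (m : ℕ) {σ : ℝ} (hσ : σ < 0) :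
    IntegrableOn (fun t : ℝ ↦ |Real.log t| ^ m * t ^ (σ - 1)) (Ioi a) := by
  have hcont : ContinuousOn (fun t : ℝ ↦ |Real.log t| ^ m * t ^ (σ - 1)) (Ioi a) := by
    intro t ht
    have ht0 : t ≠ 0 := (ha.trans ht).ne'
    exact (((Real.continuousAt_log ht0).abs.pow m).mul
      (Real.continuousAt_rpow_const _ _ (Or.inl ht0))).continuousWithinAt
  set η : ℝ := -σ / (m + 1) with hη
  have hη0 : 0 < η := by rw [hη]; exact div_pos (by linarith) (by positivity)
  have hmη : m * η < -σ := by
    rw [hη, mul_div_assoc', div_lt_iff₀ (by positivity)]; nlinarith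
  have hp1 : m * η + (σ - 1) < -1 := by linarith
  have hp2 : -(m * η) + (σ - 1) < -1 := by
    have : 0 ≤ m * η := by positivity
    linarith
  have hI : IntegrableOn (fun t : ℝ ↦ (2 / η) ^ m * (t ^ (m * η + (σ - 1)) + t ^ (-(m * η) + (σ - 1))))
      (Ioi a) :=
    ((integrableOn_Ioi_rpow_of_lt hp1 ha).add (integrableOn_Ioi_rpow_of_lt hp2 ha)).const_mul _
  refine hI.mono' (hcont.aestronglyMeasurable measurableSet_Ioi) ?_
  filter_upwards [ae_restrict_mem measurableSet_Ioi] with t ht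
  have ht0 : 0 < t := ha.trans ht
  have hr : 0 ≤ t ^ (σ - 1) := Real.rpow_nonneg ht0.le _
  rw [Real.norm_eq_abs, abs_mul, abs_pow, abs_abs, abs_of_nonneg hr]
  calc |Real.log t| ^ m * t ^ (σ - 1)
      ≤ (2 / η) ^ m * (t ^ (m * η) + t ^ (-(m * η))) * t ^ (σ - 1) :=
        mul_le_mul_of_nonneg_right (abs_log_pow_le' ht0 hη0 m) hr
    _ = (2 / η) ^ m * (t ^ (m * η + (σ - 1)) + t ^ (-(m * η) + (σ - 1))) := by
        rw [mul_assoc, add_mul, ← Real.rpow_add ht0, ← Real.rpow_add ht0]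

/-- **`𝟙_{|x|>a}|log|x||^m|x|^{σ−1}` is integrable on `ℝ`** for `σ < 0`, `a > 0`. [folklore] -/
private theorem integrable_indicator_abs_log_pow_mul_rpow {a : ℝ} (ha : 0 < a) (m : ℕ) {σ : ℝ}
    (hσ : σ < 0) :
    Integrable (Set.indicator {x : ℝ | a < |x|} fun x : ℝ ↦ (abs (Real.log |x|)) ^ m * |x| ^ (σ - 1)) := by
  rw [integrable_indicator_iff (measurableSet_lt measurable_const continuous_abs.measurable)]
  have hset : {x : ℝ | a < |x|} = Iio (-a) ∪ Ioi a := by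
    ext x; simp only [mem_setOf_eq, mem_union, mem_Iio, mem_Ioi, lt_abs, lt_neg]; tauto
  rw [hset]
  have hIoi := integrableOn_abs_log_pow_mul_rpow ha m hσ
  refine IntegrableOn.union ?_ ?_
  · have hneg : MeasurePreserving (fun x : ℝ ↦ -x) volume volume := Measure.measurePreserving_neg _
    have h3 := (hneg.integrableOn_comp_preimage (Homeomorph.neg ℝ).measurableEmbedding).2 hIoi
    have h4 : (fun x : ℝ ↦ -x) ⁻¹' Ioi a = Iio (-a) := by
      ext x; simp only [mem_preimage, mem_Ioi, mem_Iio, lt_neg]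
    rw [h4] at h3
    refine h3.congr_fun (fun x hx ↦ ?_) measurableSet_Iio
    have hx' : x < 0 := lt_trans hx (neg_neg_of_pos ha)
    simp only [Function.comp_apply, abs_of_neg hx']
  · exact hIoi.congr_fun (fun x hx ↦ by rw [abs_of_pos (ha.trans hx)]) measurableSet_Ioi

/-! ## B. The Fourier integral of `𝟙_{|x|>a}(log|x|)^k|x|^{w−1}` and its `w`-derivatives -/

/-- The kernel `e^{−2πivu}` has norm one. [folklore] -/
private theorem norm_cexp_kernel (v u : ℝ) : ‖cexp (↑(-2 * π * v * u) * I)‖ = 1 :=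
  Complex.norm_exp_ofReal_mul_I _

/-- Norm of `(log|x|)^k |x|^{w−1}` for `x ≠ 0`. [folklore] -/
private theorem norm_log_pow_abs_cpow {x : ℝ} (hx : x ≠ 0) (k : ℕ) (w : ℂ) :
    ‖((Real.log |x| : ℝ) : ℂ) ^ k * ((|x| : ℝ) : ℂ) ^ (w - 1)‖ = (abs (Real.log |x|)) ^ k * |x| ^ (w.re - 1) := by
  rw [norm_mul, norm_pow, Complex.norm_real, Real.norm_eq_abs,
    Complex.norm_cpow_eq_rpow_re_of_pos (abs_pos.2 hx), Complex.sub_re, Complex.one_re]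

/-- Continuity of `x ↦ (log|x|)^k|x|^{w−1}` away from `0`. [folklore] -/
private theorem continuousOn_log_pow_abs_cpow (k : ℕ) (w : ℂ) :
    ContinuousOn (fun x : ℝ ↦ ((Real.log |x| : ℝ) : ℂ) ^ k * ((|x| : ℝ) : ℂ) ^ (w - 1)) {x : ℝ | x ≠ 0} := by
  intro x hx
  have hx0 : |x| ≠ 0 := abs_ne_zero.2 hx
  refine ContinuousAt.continuousWithinAt ?_
  refine ((Complex.continuous_ofReal.continuousAt.comp
    ((Real.continuousAt_log hx0).comp continuous_abs.continuousAt)).pow k).mul ?_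
  exact (Complex.continuousAt_ofReal_cpow_const _ _ (Or.inr hx0)).comp continuous_abs.continuousAt

/-- Measurability of the indicator integrand. [folklore] -/
private theorem aestronglyMeasurable_indicator_log_pow_abs_cpow {a : ℝ} (ha : 0 < a) (k : ℕ) (w : ℂ) :
    AEStronglyMeasurable (Set.indicator {x : ℝ | a < |x|}
      (fun x : ℝ ↦ ((Real.log |x| : ℝ) : ℂ) ^ k * ((|x| : ℝ) : ℂ) ^ (w - 1))) volume := by
  refine (aestronglyMeasurable_indicator_iff (measurableSet_lt measurable_const
    continuous_abs.measurable)).2 ?_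
  refine ((continuousOn_log_pow_abs_cpow k w).mono fun x hx ↦ ?_).aestronglyMeasurable
    (measurableSet_lt measurable_const continuous_abs.measurable)
  exact abs_pos.1 (ha.trans hx)

/-- **Differentiation under the Fourier integral**: for `Re w₀ < 0`,
`d/dw ∫ e^{−2πivu} 𝟙_{|v|>a}(log|v|)^k|v|^{w−1} dv = ∫ e^{−2πivu} 𝟙_{|v|>a}(log|v|)^{k+1}|v|^{w−1} dv`.
[cite: Burnol2001CRAS, §1 (TeX l.326–332)] -/
theorem hasDerivAt_integral_cexp_indicator_log_pow_cpow {a : ℝ} (ha : 0 < a) (u : ℝ) (k : ℕ)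
    {w₀ : ℂ} (hw₀ : w₀.re < 0) :
    HasDerivAt (fun w : ℂ ↦ ∫ v : ℝ, cexp (↑(-2 * π * v * u) * I) *
        Set.indicator {x : ℝ | a < |x|} (fun x : ℝ ↦ ((Real.log |x| : ℝ) : ℂ) ^ k *
          ((|x| : ℝ) : ℂ) ^ (w - 1)) v)
      (∫ v : ℝ, cexp (↑(-2 * π * v * u) * I) *
        Set.indicator {x : ℝ | a < |x|} (fun x : ℝ ↦ ((Real.log |x| : ℝ) : ℂ) ^ (k + 1) *
          ((|x| : ℝ) : ℂ) ^ (w₀ - 1)) v) w₀ := by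
  set δ : ℝ := -w₀.re / 2 with hδ
  have hδ0 : 0 < δ := by rw [hδ]; linarith
  set σ₁ : ℝ := w₀.re - δ with hσ₁
  set σ₂ : ℝ := w₀.re + δ with hσ₂
  have hσ₂' : σ₂ < 0 := by rw [hσ₂, hδ]; linarith
  have hσ₁' : σ₁ < 0 := by rw [hσ₁]; linarith
  have hre : ∀ w ∈ ball w₀ δ, σ₁ < w.re ∧ w.re < σ₂ := by
    intro w hw
    have h1 : |w.re - w₀.re| < δ := by
      have := abs_re_le_norm (w - w₀)
      rw [Complex.sub_re] at this
      exact this.trans_lt (mem_ball_iff_norm.1 hw)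
    rw [abs_lt] at h1
    exact ⟨by rw [hσ₁]; linarith, by rw [hσ₂]; linarith⟩
  set S : Set ℝ := {x : ℝ | a < |x|} with hS
  have hSm : MeasurableSet S := measurableSet_lt measurable_const continuous_abs.measurable
  set F : ℂ → ℝ → ℂ := fun w v ↦ cexp (↑(-2 * π * v * u) * I) *
    S.indicator (fun x : ℝ ↦ ((Real.log |x| : ℝ) : ℂ) ^ k * ((|x| : ℝ) : ℂ) ^ (w - 1)) v with hF
  set F' : ℂ → ℝ → ℂ := fun w v ↦ cexp (↑(-2 * π * v * u) * I) *
    S.indicator (fun x : ℝ ↦ ((Real.log |x| : ℝ) : ℂ) ^ (k + 1) * ((|x| : ℝ) : ℂ) ^ (w - 1)) v with hF'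
  set bound : ℝ → ℝ := S.indicator fun x : ℝ ↦
    (abs (Real.log |x|)) ^ (k + 1) * |x| ^ (σ₁ - 1) + (abs (Real.log |x|)) ^ (k + 1) * |x| ^ (σ₂ - 1) with hbound
  have hkc : Continuous fun v : ℝ ↦ cexp (↑(-2 * π * v * u) * I) := by fun_prop
  have hmeas : ∀ w : ℂ, AEStronglyMeasurable (F w) volume := fun w ↦
    hkc.aestronglyMeasurable.mul (aestronglyMeasurable_indicator_log_pow_abs_cpow ha k w)
  -- integrability of the integrands for `Re w < 0`
  have hint : ∀ (m : ℕ) {w : ℂ}, w.re < 0 → Integrable (fun v : ℝ ↦ cexp (↑(-2 * π * v * u) * I) *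
      S.indicator (fun x : ℝ ↦ ((Real.log |x| : ℝ) : ℂ) ^ m * ((|x| : ℝ) : ℂ) ^ (w - 1)) v) := by
    intro m w hw
    refine (integrable_indicator_abs_log_pow_mul_rpow ha m hw).mono'
      (hkc.aestronglyMeasurable.mul (aestronglyMeasurable_indicator_log_pow_abs_cpow ha m w))
      (Eventually.of_forall fun v ↦ ?_)
    rw [norm_mul, norm_cexp_kernel, one_mul]
    by_cases hv : v ∈ S
    · have hv0 : v ≠ 0 := abs_pos.1 (ha.trans hv)
      rw [Set.indicator_of_mem hv, Set.indicator_of_mem hv, norm_log_pow_abs_cpow hv0]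
    · rw [Set.indicator_of_notMem hv, Set.indicator_of_notMem hv, norm_zero]
  have key := hasDerivAt_integral_of_dominated_loc_of_deriv_le (μ := volume)
    (x₀ := w₀) (F := F) (F' := F') (bound := bound) (ball_mem_nhds w₀ hδ0)
    (Eventually.of_forall hmeas) (hint k hw₀)
    (hkc.aestronglyMeasurable.mul (aestronglyMeasurable_indicator_log_pow_abs_cpow ha (k + 1) w₀))
    ?_ ?_ ?_
  · exact key.2
  · -- domination on the ball
    refine Eventually.of_forall fun v w hw ↦ ?_
    obtain ⟨h1, h2⟩ := hre w hw
    rw [hF', hbound]; dsimp only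
    rw [norm_mul, norm_cexp_kernel, one_mul]
    by_cases hv : v ∈ S
    · have hva : a < |v| := hv
      have hv0' : 0 < |v| := ha.trans hva
      have hv0 : v ≠ 0 := abs_pos.1 hv0'
      rw [Set.indicator_of_mem hv, Set.indicator_of_mem hv, norm_log_pow_abs_cpow hv0, ← mul_add]
      refine mul_le_mul_of_nonneg_left ?_ (pow_nonneg (abs_nonneg _) _)
      have hp1 : 0 ≤ |v| ^ (σ₁ - 1) := Real.rpow_nonneg hv0'.le _
      have hp2 : 0 ≤ |v| ^ (σ₂ - 1) := Real.rpow_nonneg hv0'.le _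
      rcases le_or_gt 1 |v| with hv1 | hv1
      · calc |v| ^ (w.re - 1) ≤ |v| ^ (σ₂ - 1) := Real.rpow_le_rpow_of_exponent_le hv1 (by linarith)
          _ ≤ |v| ^ (σ₁ - 1) + |v| ^ (σ₂ - 1) := by linarith
      · calc |v| ^ (w.re - 1) ≤ |v| ^ (σ₁ - 1) :=
            Real.rpow_le_rpow_of_exponent_ge hv0' hv1.le (by linarith)
          _ ≤ |v| ^ (σ₁ - 1) + |v| ^ (σ₂ - 1) := by linarith
    · rw [Set.indicator_of_notMem hv, Set.indicator_of_notMem hv, norm_zero]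
  · -- the majorant is integrable
    have h1 := integrable_indicator_abs_log_pow_mul_rpow ha (k + 1) hσ₁'
    have h2 := integrable_indicator_abs_log_pow_mul_rpow ha (k + 1) hσ₂'
    refine (h1.add h2).congr (Eventually.of_forall fun v ↦ ?_)
    rw [hbound]
    simp only [Pi.add_apply, Set.indicator_apply]
    split_ifs <;> simp
  · -- pointwise derivative in `w`
    refine Eventually.of_forall fun v w _ ↦ ?_
    rw [hF, hF']; dsimp only
    by_cases hv : v ∈ S
    · have hv0 : v ≠ 0 := abs_pos.1 (ha.trans hv)
      have hvc : ((|v| : ℝ) : ℂ) ≠ 0 := Complex.ofReal_ne_zero.2 (abs_ne_zero.2 hv0)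
      simp only [Set.indicator_of_mem hv]
      have h1 : HasDerivAt (fun w : ℂ ↦ ((|v| : ℝ) : ℂ) ^ (w - 1))
          (((|v| : ℝ) : ℂ) ^ (w - 1) * Complex.log ((|v| : ℝ) : ℂ) * 1) w := by
        have := ((hasDerivAt_id w).sub_const (1 : ℂ)).const_cpow (c := ((|v| : ℝ) : ℂ)) (Or.inl hvc)
        simpa using this
      have h2 := (h1.const_mul (((Real.log |v| : ℝ) : ℂ) ^ k)).const_mul (cexp (↑(-2 * π * v * u) * I))
      refine h2.congr_deriv ?_
      rw [Complex.ofReal_log (abs_nonneg v)]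
      ring
    · simp only [Set.indicator_of_notMem hv, mul_zero]
      exact hasDerivAt_const w 0

/-- **`𝓕(𝟙_{|x|>a}(log|x|)^k|x|^{w−1})(u) = (d/dw)^k C_a(u,w)`** for `a > 0`, `u ≠ 0`, `Re w < 0`: the
cosine transform of `𝟙_{t≥a}(log t)^k t^{w−1}` is the `k`-th `w`-derivative of Burnol's kernel
(`k = 0`: `SonineMellin.fourierIntegral_gw`). [cite: Burnol2001CRAS, §1 (TeX l.326–332, 393–396)] -/
theorem fourier_indicator_log_pow_cpow {a : ℝ} (ha : 0 < a) {u : ℝ} (hu : u ≠ 0) (k : ℕ) {w : ℂ}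
    (hw : w.re < 0) :
    𝓕 (Set.indicator {x : ℝ | a < |x|} (fun x : ℝ ↦ ((Real.log |x| : ℝ) : ℂ) ^ k *
      ((|x| : ℝ) : ℂ) ^ (w - 1))) u = iteratedDeriv k (cosKernel a u) w := by
  set U : Set ℂ := {w : ℂ | w.re < 0} with hU
  have hUo : IsOpen U := isOpen_lt Complex.continuous_re continuous_const
  -- the family `Φ_k(w) = ∫ e^{−2πivu} 𝟙 (log|v|)^k |v|^{w−1} dv`
  set Φ : ℕ → ℂ → ℂ := fun k w ↦ ∫ v : ℝ, cexp (↑(-2 * π * v * u) * I) *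
    Set.indicator {x : ℝ | a < |x|} (fun x : ℝ ↦ ((Real.log |x| : ℝ) : ℂ) ^ k *
      ((|x| : ℝ) : ℂ) ^ (w - 1)) v with hΦ
  have hfourier : ∀ (k : ℕ) (w : ℂ), 𝓕 (Set.indicator {x : ℝ | a < |x|}
      (fun x : ℝ ↦ ((Real.log |x| : ℝ) : ℂ) ^ k * ((|x| : ℝ) : ℂ) ^ (w - 1))) u = Φ k w := by
    intro k w
    rw [Real.fourier_real_eq_integral_exp_smul]
    simp only [smul_eq_mul, hΦ]
  -- `Φ_0 = C_a(u,·)` on `U`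
  have h0 : ∀ w ∈ U, cosKernel a u w = Φ 0 w := by
    intro w hw
    rw [← hfourier 0 w, ← fourierIntegral_gw ha hw hu]
    have e : (Set.indicator {x : ℝ | a < |x|} fun x : ℝ ↦ ((|x| : ℝ) : ℂ) ^ (w - 1)) =
        Set.indicator {x : ℝ | a < |x|} (fun x : ℝ ↦ ((Real.log |x| : ℝ) : ℂ) ^ 0 *
          ((|x| : ℝ) : ℂ) ^ (w - 1)) := by
      funext x
      simp only [Set.indicator_apply, pow_zero, one_mul]
    rw [e]
  -- induction: `iteratedDeriv k (C_a(u,·)) = Φ_k` on `U`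
  have hind : ∀ k : ℕ, ∀ w ∈ U, iteratedDeriv k (cosKernel a u) w = Φ k w := by
    intro k
    induction k with
    | zero => intro w hw; rw [iteratedDeriv_zero]; exact h0 w hw
    | succ k ih =>
      intro w hw
      rw [iteratedDeriv_succ]
      have hev : iteratedDeriv k (cosKernel a u) =ᶠ[𝓝 w] Φ k := by
        filter_upwards [hUo.mem_nhds hw] with z hz
        exact ih z hz
      rw [hev.deriv_eq]
      exact (hasDerivAt_integral_cexp_indicator_log_pow_cpow ha u k hw).deriv
  rw [hfourier, hind k w hw]

end Burnol2001

end Literature.Analysis.DeBrangesSpaces
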